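import Mathlib
import Literature.Computability.MetaComplexity.SmolenskyDimensionBound

/-!
# A polynomial of bounded total degree restricts to the cube inside `lowDeg`

A polynomial `P ∈ F[x₁, …, xₙ]` of total degree `≤ d`, evaluated on the Boolean cube `{0,1}ⁿ`
at the bit vector `xᵢ = [bᵢ]`, is a function in Smolensky's degree filtration `lowDeg F n d`
(the span of the multilinear monomials `x_S`, `|S| ≤ d`): each monomial `c · Π xᵢ^{eᵢ}` of `P`
restricts to `c · x_S` with `S` its support (`xᵢ^e = xᵢ` on the cube for `e ≥ 1`), and
`|S| ≤ Σ eᵢ ≤ totalDegree P ≤ d`. Helper for line Sketch/LAR of crux stmt-QuantumAdvantage-1392: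
the crux quantifies over `P : MvPolynomial (Fin n) (ZMod 2)` of total degree `≤ (log₂ n)^A`
evaluated at the digits, and the LAR composition needs this evaluation, as a function on the
cube, to lie in `lowDeg` so that the Smolensky–Carlet count applies. (The converse direction,
`lowDeg →` honest polynomials, is `exists_mvPolynomial_of_mem_lowDeg` in
`MobiusLadderLiouvilleNotAC0Xor.lean`.)
-/

namespace Summit.QuantumAdvantage.DigitPolyUniformity.SketchLAR

open Finset Module
open Literature.Computability.MetaComplexity.Smolensky (CubeFn mono lowDeg)

namespace EvalMemLowDeg

/-- Bits are idempotent: `[c]^e = [c]` for `e ≠ 0`. [folklore] -/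
theorem boolBit_pow {F : Type*} [Field F] (c : Bool) {e : ℕ} (he : e ≠ 0) :
    (if c then (1 : F) else 0) ^ e = if c then 1 else 0 := by
  cases c
  · rw [if_neg Bool.false_ne_true, zero_pow he]
  · rw [if_pos rfl, one_pow]

/-- Evaluating the monomial `c · x^s` at a point `b` of the cube gives `c · x_{supp s}(b)`.
[folklore] -/
theorem eval_monomial_cube {F : Type*} [Field F] {n : ℕ} (s : Fin n →₀ ℕ) (c : F)
    (b : Fin n → Bool) :
    MvPolynomial.eval (fun i => if b i then (1 : F) else 0) (MvPolynomial.monomial s c) =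
      c * mono F s.support b := by
  rw [MvPolynomial.eval_monomial, Finsupp.prod]
  unfold mono
  exact congrArg (c * ·) (Finset.prod_congr rfl fun i hi =>
    boolBit_pow (b i) (Finsupp.mem_support_iff.1 hi))

/-- On the cube, `P = Σ_{s ∈ supp P} (coeff s P) · x_{supp s}` as functions. [folklore] -/
theorem eval_cube_eq_sum {F : Type*} [Field F] {n : ℕ} (P : MvPolynomial (Fin n) F) :
    (fun b : Fin n → Bool => MvPolynomial.eval (fun i => if b i then (1 : F) else 0) P) =
      ∑ s ∈ P.support, P.coeff s • mono F s.support := by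
  funext b
  rw [Finset.sum_apply]
  conv_lhs => rw [P.as_sum]
  rw [map_sum]
  refine Finset.sum_congr rfl fun s _ => ?_
  rw [Pi.smul_apply, smul_eq_mul]
  exact eval_monomial_cube s (P.coeff s) b

end EvalMemLowDeg

/-- **A polynomial of total degree `≤ d` evaluates on the Boolean cube to a function in
Smolensky's `lowDeg d`**: `b ↦ P([b₁], …, [bₙ]) ∈ span {x_S : |S| ≤ d}`. [folklore] -/
theorem stub_eval_mem_lowDeg {F : Type*} [Field F] {n d : ℕ} (P : MvPolynomial (Fin n) F)
    (hP : P.totalDegree ≤ d) :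
    (fun b : Fin n → Bool => MvPolynomial.eval (fun i => if b i then (1 : F) else 0) P) ∈
      lowDeg F n d := by
  rw [EvalMemLowDeg.eval_cube_eq_sum P]
  refine Submodule.sum_mem _ fun s hs => Submodule.smul_mem _ _ ?_
  -- `|supp s| ≤ Σᵢ sᵢ` (each exponent on the support is `≥ 1`) `≤ totalDegree P ≤ d`
  have hcard : s.support.card ≤ s.sum fun _ e => e := by
    rw [Finsupp.sum, Finset.card_eq_sum_ones]
    exact Finset.sum_le_sum fun i hi => Nat.one_le_iff_ne_zero.2 (Finsupp.mem_support_iff.1 hi)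
  exact Literature.Computability.MetaComplexity.Smolensky.mono_mem_lowDeg
    (hcard.trans ((MvPolynomial.le_totalDegree hs).trans hP))

end Summit.QuantumAdvantage.DigitPolyUniformity.SketchLAR
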